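import Literature.Probability.FitznerVanDerHofstad2017.SrwIntegralJFarField
import Literature.Probability.FitznerVanDerHofstad2017.SrwIntegralParityMonotone
import HarnessLib

/-!
# `𝓙_{n,l}(x)` ([NoBLE17] (3.30), thesis (3.6.18) `I^M_{n,l}`, `SRW.nb` `IM[n,l,x]`): the PER-NODE cone
majorant and the PER-CONE sup rule (F-IM, b2b-lace D41 / C22 (ii); complements `SrwIntegralJFarField`)

CITATION HEADER (PLACEMENT v2). This module is part of a certified REPRODUCTION of:
R. Fitzner, R. van der Hofstad, *Generalized approach to the non-backtracking lace expansion*,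
Probab. Theory Related Fields 169 (2017) 1041–1119 [NoBLE17] (cited in the arXiv:1506.07969 numbering)
and *Mean-field behavior for nearest-neighbor percolation in d > 10*, Electron. J. Probab. 22 (2017)
no. 43 [FvdH17]; and of R. Fitzner's thesis (TU/e 2013), §3.6.  Origin: build `lace` (b2b), seat tail-g3
(TAIL-BOUND ANALYST), LEMMAS node N46 `fim_sup_reduction`.

## The object and the gap

`srwJ d m l x = 𝓙_{m-2,l}(x) = I_{m,l+1}(x) − (1/d) I_{m+1,l}(x) + (1/(2d²)) Σ_j [I_{m+1,l}(x+2e_j) +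
I_{m+1,l}(x−2e_j)]` (`SrwIntegralJFarField`; [NoBLE17] (3.30), held copy p. 80; thesis (3.6.18) p. 101).
The notebooks realise `sup_{x ∈ S} 𝓙` over the INFINITE sets `S = {x ≠ 0}`, `{‖x‖₁ ≥ 2}`, `{‖x‖₁ ≥ 3}`
as a `Max` over two or three lowest-order nodes (thesis (3.6.19) p. 102: "Using the monotonicity of
I_{n,m} and symmetry"), and — inside the COMPOSITE bounds `BoundH = Σ_{i=1}^{5} BoundH[i]`
(`General.nb`; `Percolation.nb` `BoundFThreeBound[n,l,vs]`) — take `Max_v Σ_i BoundH[i](v)` over a node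
list, which is justified only if ONE node `v(x)` dominates EVERY ingredient at `x` simultaneously
(b2b-lace CENSUS-C19b rows 3–5: `v(x)` = the lowest node below the sorted `|x|`).  For the monotone
ingredients (`I`, by Lemma M = `absMonotone_srwI`; `L`/`T`/`U` by sorted majorisation) this is automatic;
for the signed combination `𝓙` it is the PER-CONE statement
  `(PC)   𝓙_c(x) ≤ 𝓙_c(v)` for every `x` whose sorted `|x|` dominates the node `v` coordinatewise,
which is stronger than the shell statement `sup_{‖x‖₁ ≥ s} 𝓙_c = max over nodes` and, like it, has no
proof in print.  `SrwIntegralJFarField` (THM A–C) settles the SHELL statement modulo finitely many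
evaluations via layer constants `Ī + F̄/(2d)`.  This file settles (PC) — and re-derives the shell form with
a sharper, per-point frontier — modulo finitely many evaluations, with NO hypothesis beyond `d ≥ 2m + 3`:

* `srwJ_le_srwJcone` (CONE MAJORANT, per point): for `w ∈ ℤ^d_{≥0}` and every `x` with `|x_j| ≥ w_j`
  (all `j`):  `𝓙_{m-2,l}(x) ≤ B_{m-2,l}(w) := I_{m,l+1}(w) + (1/(2d²)) Σ_{j=1}^{d} I_{m+1,l}(w^{(j)})`,
  `w^{(j)} = w[j ↦ max(w_j − 2, 0)]` (`srwJcone`).  Ingredients: Lemma M for `I_{m,l+1}` and for the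
  inward `2e_j` shifts, parity-class monotonicity (`parityMonotone_srwI`) for the outward shifts,
  `I ≥ 0`; the left-over `−(1/(2d)) I_{m+1,l}(x)` is dropped (cf. THM A of `SrwIntegralJFarField`,
  where the `2d` dominated shifts cancel `−f/d` exactly; bounding its surviving inward differences by
  `f(w^{(j)})` gives the same `B(w)`).
* `exists_spAct_antitone_ge` (sorting: some `σ ∈ W_d` maps `x` to the non-increasing rearrangement
  `x*` of `|x|`, and `x* ≥ v` for every sorted `v ≤ |x|`) and `exists_antitone_between` (filling: a
  sorted `w`, `v ≤ w ≤ x*`, of any prescribed `ℓ¹`-norm in `[‖v‖₁, ‖x*‖₁]`).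
* `srwJ_le_of_coneTables` (RULE FIM-SUP, per cone): `v` sorted, `≥ 0`, `‖v‖₁ ≤ R + 1`; IF `𝓙(w) ≤ M`
  for the finitely many SORTED `w ≥ v` with `s ≤ ‖w‖₁ ≤ R` AND `B(w) ≤ M` for the finitely many sorted
  `w ≥ v` with `‖w‖₁ = R + 1`, THEN `𝓙(x) ≤ M` for EVERY `x` with `|x_j| ≥ v_j` (all `j`) and
  `‖x‖₁ ≥ s` — hence, by `srwJ_spAct`, for every `x` with sorted `|x| ≥ v`.  `M = 𝓙(v)`, `s = 0` is
  (PC); `v = 0`, `s ∈ {1,2,3}`, `M = max over the node list` is the shell rule (`srwJ_le_of_shellTables`).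

The premises are inequalities between values of `I_{m,l+1}`, `I_{m+1,l}` at sorted lattice points of
`‖·‖₁ ≤ R + 1` — two-engine numbers (num seats); they are NOT part of this file.  Float screen (tail-g3
`fim/fimscan*.py`, an `I_{n,l}` evaluator by one-dimensional Bessel generating functions, validated
against engine-A balls to `1e-6`, `𝓙` values = ref2-g8 `imscreen8` to all digits): (PC) holds and its
premises close, for EVERY `(c, node list)` consumed by `Percolation.nb`, at `d = 10, 11, 12` with a
uniform `R = 6` (frontier `‖w‖₁ = 7`; worst frontier ratio `B(w)/𝓙(v)` = 0.886 / 0.462 / 0.270, worst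
inner ratio 0.732 / 0.692 / 0.674), per-cell minimal `R` between 2 and 6; the extra `Q`-node `2e₁+2e₂`
(b2b-lace C21) satisfies (PC) too (`R ≤ 8` at `d = 10`, `≤ 5` at `d = 11, 12`).  (PC) is FALSE at some
cells NOT consumed (`𝓙_{-1,7}`, `𝓙_{-1,9}`: `1⁴` beats the `Q`-nodes; `𝓙_{-1,2k}`: `1³` beats the
`S2`-nodes), in agreement with ref2-g8 / lit-g5 — so (3.6.19)-type rules are cell-by-cell facts, which is
what the finite premises express.
-/

noncomputable section

namespace Literature.Probability.FitznerVanDerHofstad2017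

open MeasureTheory Finset Real Filter Topology

variable {d : ℕ}

/-! ### The cone majorant of `𝓙` -/

/-- The cone majorant `B_{m-2,l}(w) = I_{m,l+1}(w) + (1/(2d²)) Σ_j I_{m+1,l}(w^{(j)})`,
`w^{(j)} = w[j ↦ max(w_j − 2, 0)]`. [folklore] -/
def srwJcone (d m l : ℕ) (w : Fin d → ℤ) : ℝ :=
  srwI d m (l + 1) w
    + (∑ j : Fin d, srwI d (m + 1) l (Function.update w j (max (w j - 2) 0))) / (2 * (d : ℝ) ^ 2)

/-- **CONE MAJORANT.** For `m ≥ 1`, `d ≥ 2m + 3`, `w ∈ ℤ^d_{≥ 0}` and every `x` with `|x_j| ≥ w_j`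
(all `j`): `𝓘_{m-2,l}(x) ≤ B_{m-2,l}(w)`.  Proof: `I_{m,l+1}(x) ≤ I_{m,l+1}(w)` (Lemma M); of the `2d`
shifted terms, the outward one in direction `j` is `≤ I_{m+1,l}(x)` (parity-class monotonicity) and the
inward one is `≤ I_{m+1,l}(w^{(j)})` (Lemma M; for `|x_j| ≤ 1` both are `≤ I(x) ≤ I(w^{(j)})`); the
resulting `−(1/(2d)) I_{m+1,l}(x) ≤ 0` is dropped. [folklore] -/
theorem srwJ_le_srwJcone {m : ℕ} (hm : 1 ≤ m) (hd : 2 * (m + 1) + 1 ≤ d) (l : ℕ)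
    (x w : Fin d → ℤ) (hw0 : ∀ j, 0 ≤ w j) (hwx : ∀ j, w j ≤ |x j|) :
    srwJ d m l x ≤ srwJcone d m l w := by
  have hd' : 2 * m + 1 ≤ d := by omega
  have hdpos : (0 : ℝ) < d := by exact_mod_cast (show 0 < d by omega)
  set f := srwI d (m + 1) l with hf
  set g := srwI d m (l + 1) with hg
  have hfmono : AbsMonotone f := absMonotone_srwI (by omega) hd l
  have hfpar : ParityMonotone f := parityMonotone_srwI (m + 1) hd l
  have hgmono : AbsMonotone g := absMonotone_srwI hm hd' (l + 1)
  have hf0 : 0 ≤ f x := srwI_nonneg (m + 1) hd l x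
  have hgxw : g x ≤ g w := hgmono x w fun μ => by rw [abs_of_nonneg (hw0 μ)]; exact hwx μ
  -- the inward point `w^{(j)}` is dominated by `x ± 2e_j` whenever `|x_j ± 2| ≥ |x_j| - 2`
  have hdom : ∀ (j : Fin d) (s : ℤ), max (w j - 2) 0 ≤ |x j + s| →
      f (x + axisVec j s) ≤ f (Function.update w j (max (w j - 2) 0)) := by
    intro j s hs
    refine hfmono _ _ fun μ => ?_
    by_cases hμ : μ = j
    · subst hμ
      rw [Function.update_self, Pi.add_apply, abs_of_nonneg (le_max_right _ _)]
      simpa [axisVec] using hs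
    · rw [Function.update_of_ne hμ, Pi.add_apply, abs_of_nonneg (hw0 μ)]
      simpa [axisVec, hμ] using hwx μ
  -- the outward shift is parity-dominated by `x`
  have hout : ∀ (j : Fin d) (s : ℤ), (s = 2 ∨ s = -2) → |x j| ≤ |x j + s| →
      f (x + axisVec j s) ≤ f x := by
    intro j s hs habs
    refine hfpar _ _ fun μ => ?_
    by_cases hμ : μ = j
    · subst hμ
      refine ⟨by simpa [axisVec] using habs, ?_⟩
      simp only [Pi.add_apply, axisVec, if_true]
      rcases hs with rfl | rfl <;> omega
    · simp [axisVec, hμ]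
  have hpair : ∀ j : Fin d, f (x + axisVec j 2) + f (x - axisVec j 2) ≤
      f x + f (Function.update w j (max (w j - 2) 0)) := by
    intro j
    have hsub : x - axisVec j 2 = x + axisVec j (-2) := by
      rw [axisVec_neg, sub_eq_add_neg]
    rw [hsub]
    have hwj := hwx j
    rcases le_or_gt 0 (x j) with hxj | hxj
    · -- `x_j ≥ 0`: `+2e_j` outward, `-2e_j` inward
      have h1 : f (x + axisVec j 2) ≤ f x := hout j 2 (Or.inl rfl) (by
        rw [abs_of_nonneg hxj, abs_of_nonneg (by linarith)]; linarith)
      have h2 : f (x + axisVec j (-2)) ≤ f (Function.update w j (max (w j - 2) 0)) := hdom j (-2) (by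
        rw [abs_of_nonneg hxj] at hwj
        exact max_le (by linarith [le_abs_self (x j + -2)]) (abs_nonneg _))
      linarith
    · -- `x_j < 0`: `-2e_j` outward, `+2e_j` inward
      have h1 : f (x + axisVec j (-2)) ≤ f x := hout j (-2) (Or.inr rfl) (by
        rw [abs_of_neg hxj, abs_of_neg (by linarith)]; linarith)
      have h2 : f (x + axisVec j 2) ≤ f (Function.update w j (max (w j - 2) 0)) := hdom j 2 (by
        rw [abs_of_neg hxj] at hwj
        exact max_le (by linarith [neg_le_abs (x j + 2)]) (abs_nonneg _))
      linarith
  have hsum : ∑ j : Fin d, (f (x + axisVec j 2) + f (x - axisVec j 2)) ≤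
      (d : ℝ) * f x + ∑ j : Fin d, f (Function.update w j (max (w j - 2) 0)) := by
    calc ∑ j : Fin d, (f (x + axisVec j 2) + f (x - axisVec j 2))
        ≤ ∑ j : Fin d, (f x + f (Function.update w j (max (w j - 2) 0))) := Finset.sum_le_sum fun j _ => hpair j
      _ = (d : ℝ) * f x + ∑ j : Fin d, f (Function.update w j (max (w j - 2) 0)) := by
          rw [Finset.sum_add_distrib, Finset.sum_const, Finset.card_univ, Fintype.card_fin, nsmul_eq_mul]
  have h2d : (0 : ℝ) < 2 * (d : ℝ) ^ 2 := by positivity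
  unfold srwJ srwJcone
  rw [← hf, ← hg]  -- harmless if `set` already rewrote
  have step : (∑ j : Fin d, (f (x + axisVec j 2) + f (x - axisVec j 2))) / (2 * (d : ℝ) ^ 2) ≤
      ((d : ℝ) * f x + ∑ j : Fin d, f (Function.update w j (max (w j - 2) 0))) / (2 * (d : ℝ) ^ 2) :=
    div_le_div_of_nonneg_right hsum h2d.le
  have key : -(f x / d) + ((d : ℝ) * f x + ∑ j : Fin d, f (Function.update w j (max (w j - 2) 0)))
        / (2 * (d : ℝ) ^ 2)
      = (∑ j : Fin d, f (Function.update w j (max (w j - 2) 0))) / (2 * (d : ℝ) ^ 2) - f x / (2 * d) := by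
    field_simp
    ring
  have hdrop : 0 ≤ f x / (2 * d) := by positivity
  linarith [step, key, hgxw, hdrop]

/-! ### Sorting: the decreasing rearrangement of `|x|` dominates every sorted `v ≤ |x|` -/

/-- For `v` non-increasing with `v_j ≤ |x_j|` there is `σ ∈ W_d` with `σx = ` the non-increasing
rearrangement of `|x|`; it is `≥ v` coordinatewise. [folklore] -/
theorem exists_spAct_antitone_ge (x v : Fin d → ℤ) (hv : Antitone v) (hvx : ∀ j, v j ≤ |x j|) :
    ∃ τ : SgnPermPair d, Antitone (spAct τ x) ∧ (∀ j, v j ≤ spAct τ x j) ∧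
      (∀ j, spAct τ x j = |x (τ.1 j)|) := by
  classical
  set a : Fin d → ℤ := fun i => |x i| with ha
  set π₀ : Equiv.Perm (Fin d) := Tuple.sort a with hπ₀
  have hmono : Monotone (a ∘ π₀) := Tuple.monotone_sort a
  set πr : Equiv.Perm (Fin d) := Fin.revPerm.trans π₀ with hπr
  have hπapp : ∀ i, πr i = π₀ (Fin.rev i) := fun i => by simp [hπr]
  let τ : SgnPermPair d := (πr, fun i => signUnits x (πr i))
  have hτ : ∀ j, spAct τ x j = |x (τ.1 j)| := by
    intro j
    rw [spAct_apply]
    show ((signUnits x (πr j) : ℤˣ) : ℤ) * x (πr j) = |x (πr j)|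
    unfold signUnits
    split_ifs with h
    · simp [abs_of_nonneg h]
    · simp [abs_of_neg (not_le.mp h)]
  have hb : ∀ j, spAct τ x j = a (π₀ (Fin.rev j)) := fun j => by
    rw [hτ]
    show |x (πr j)| = a (π₀ (Fin.rev j))
    rw [hπapp]
  refine ⟨τ, ?_, ?_, hτ⟩
  · intro i j hij
    rw [hb, hb]
    exact hmono (Fin.rev_le_rev.mpr hij)
  · intro i
    by_contra hlt
    push Not at hlt
    rw [hb] at hlt
    -- the `d - i` indices `π₀ t`, `t ≤ rev i`, all carry `a`-values `< v i`, hence lie strictly above `i`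
    set L : Finset (Fin d) := (Finset.Iic (Fin.rev i)).image π₀ with hL
    have hcardL : L.card = (Fin.rev i : ℕ) + 1 := by
      rw [hL, Finset.card_image_of_injective _ π₀.injective, Fin.card_Iic]
    have hsub : L ⊆ Finset.Ioi i := by
      intro μ hμ
      rw [hL, Finset.mem_image] at hμ
      obtain ⟨t, ht, rfl⟩ := hμ
      rw [Finset.mem_Iic] at ht
      rw [Finset.mem_Ioi]
      have h1 : a (π₀ t) ≤ a (π₀ (Fin.rev i)) := hmono ht
      have h2 : v (π₀ t) ≤ a (π₀ t) := hvx _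
      by_contra hle
      push Not at hle
      have h3 := hv hle
      linarith
    have hcard := Finset.card_le_card hsub
    rw [hcardL, Fin.card_Ioi] at hcard
    have := Fin.val_rev i
    have hi := i.isLt
    omega

/-! ### Filling: a sorted vector between `v` and `x*` with prescribed `ℓ¹`-norm -/

/-- Between sorted `v ≤ a` one can fit a sorted `w`, `v ≤ w ≤ a`, with any prescribed coordinate sum
`N ∈ [Σ v, Σ a]`. [folklore] -/
theorem exists_antitone_between (v : Fin d → ℤ) (hv : Antitone v) :
    ∀ (n : ℕ) (a : Fin d → ℤ), Antitone a → (∀ j, v j ≤ a j) → ∀ (N : ℤ), ∑ j, v j ≤ N →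
      N ≤ ∑ j, a j → ∑ j, a j - N ≤ n →
      ∃ w : Fin d → ℤ, Antitone w ∧ (∀ j, v j ≤ w j) ∧ (∀ j, w j ≤ a j) ∧ ∑ j, w j = N := by
  classical
  intro n
  induction n with
  | zero =>
      intro a ha hva N _ hNa hn
      exact ⟨a, ha, hva, fun j => le_rfl, by push_cast at hn; linarith⟩
  | succ n ih =>
      intro a ha hva N hvN hNa hn
      by_cases heq : ∑ j, a j = N
      · exact ⟨a, ha, hva, fun j => le_rfl, heq⟩
      have hgt : N < ∑ j, a j := lt_of_le_of_ne hNa (Ne.symm heq)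
      -- some coordinate is strictly above `v`
      set T : Finset (Fin d) := Finset.univ.filter fun j => v j < a j with hT
      have hTne : T.Nonempty := by
        by_contra hem
        rw [Finset.not_nonempty_iff_eq_empty, hT, Finset.filter_eq_empty_iff] at hem
        have : ∑ j, a j ≤ ∑ j, v j :=
          Finset.sum_le_sum fun j hj => not_lt.mp (hem hj)
        linarith
      set j₀ := T.max' hTne with hj₀
      have hj₀T : j₀ ∈ T := Finset.max'_mem T hTne
      have hj₀lt : v j₀ < a j₀ := by
        have := hj₀T; rw [hT, Finset.mem_filter] at this; exact this.2
      have habove : ∀ k, j₀ < k → a k ≤ v k := by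
        intro k hk
        by_contra hcon
        push Not at hcon
        have hkT : k ∈ T := by rw [hT, Finset.mem_filter]; exact ⟨Finset.mem_univ _, hcon⟩
        have := T.le_max' k hkT
        rw [← hj₀] at this
        exact absurd hk (not_lt.mpr this)
      -- lower coordinate `j₀` by one
      set a' : Fin d → ℤ := fun k => a k - if k = j₀ then 1 else 0 with ha'
      have ha'le : ∀ k, a' k ≤ a k := fun k => by
        simp only [ha']; split_ifs <;> linarith
      have ha'v : ∀ k, v k ≤ a' k := fun k => by
        simp only [ha']
        split_ifs with h
        · subst h; linarith
        · linarith [hva k]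
      have ha'anti : Antitone a' := by
        intro k₁ k₂ hk
        show a k₂ - (if k₂ = j₀ then 1 else 0) ≤ a k₁ - (if k₁ = j₀ then 1 else 0)
        have hkk := ha hk
        by_cases h2 : k₂ = j₀
        · rw [if_pos h2]
          by_cases h1 : k₁ = j₀
          · rw [if_pos h1]; linarith
          · rw [if_neg h1]; linarith
        · rw [if_neg h2]
          by_cases h1 : k₁ = j₀
          · rw [if_pos h1]
            rw [h1] at hk
            have hk' : j₀ < k₂ := lt_of_le_of_ne hk (Ne.symm h2)
            have h3 := habove k₂ hk'
            have h4 := hv hk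
            rw [h1]
            linarith
          · rw [if_neg h1]; linarith
      have hsum' : ∑ k, a' k = ∑ k, a k - 1 := by
        simp only [ha', Finset.sum_sub_distrib, Finset.sum_ite_eq', Finset.mem_univ, if_true]
      obtain ⟨w, hw, hvw, hwa, hwN⟩ :=
        ih a' ha'anti ha'v N hvN (by rw [hsum']; omega) (by rw [hsum']; push_cast at hn ⊢; linarith)
      exact ⟨w, hw, hvw, fun j => (hwa j).trans (ha'le j), hwN⟩

/-! ### The rule FIM-SUP -/

/-- **Rule FIM-SUP (per cone / per shell), kernel form.**  `m ≥ 1`, `d ≥ 2m + 3`; `v ∈ ℤ^d` sorted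
(non-increasing) and `≥ 0` with `‖v‖₁ ≤ R + 1`; `s ∈ ℕ`.  Suppose the finitely many TABLE inequalities
* inner: `𝓘_{m-2,l}(w) ≤ M` for every sorted `w ≥ v` (coordinatewise) with `s ≤ ‖w‖₁ ≤ R`,
* frontier: `B_{m-2,l}(w) ≤ M` for every sorted `w ≥ v` with `‖w‖₁ = R + 1`.
Then `𝓘_{m-2,l}(x) ≤ M` for EVERY `x ∈ ℤ^d` with `|x_j| ≥ v_j` for all `j` and `‖x‖₁ ≥ s`
(and, by `srwJ_spAct`, for every `x` in the `W_d`-orbit of such a point).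
USES: `v = 0`, `s = 1, 2, 3`, `M = max_{node} 𝓘(node)` gives `sup_{x ≠ 0 / ‖x‖₁ ≥ 2 / ‖x‖₁ ≥ 3} 𝓘 ≤ M`
(`BoundFThreeInital`); `v` = a node, `s = 0`, `M = 𝓘(v)` gives "the node maximises `𝓘` over its upper
cone" (composite `BoundH` consumers). [folklore] -/
theorem srwJ_le_of_coneTables {m : ℕ} (hm : 1 ≤ m) (hd : 2 * (m + 1) + 1 ≤ d) (l s R : ℕ) (M : ℝ)
    (v : Fin d → ℤ) (hv : Antitone v) (hv0 : ∀ j, 0 ≤ v j) (hvR : ∑ j, v j ≤ R + 1)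
    (hInner : ∀ w : Fin d → ℤ, Antitone w → (∀ j, v j ≤ w j) → (s : ℤ) ≤ ∑ j, w j →
      ∑ j, w j ≤ R → srwJ d m l w ≤ M)
    (hFront : ∀ w : Fin d → ℤ, Antitone w → (∀ j, v j ≤ w j) → ∑ j, w j = R + 1 →
      srwJcone d m l w ≤ M)
    (x : Fin d → ℤ) (hx : ∀ j, v j ≤ |x j|) (hxs : (s : ℤ) ≤ ∑ j, |x j|) :
    srwJ d m l x ≤ M := by
  obtain ⟨τ, hanti, hge, habs⟩ := exists_spAct_antitone_ge x v hv hx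
  set y := spAct τ x with hy
  have hy0 : ∀ j, 0 ≤ y j := fun j => by rw [habs]; exact abs_nonneg _
  have hyabs : ∀ j, |y j| = y j := fun j => abs_of_nonneg (hy0 j)
  have hysum : ∑ j, y j = ∑ j, |x j| := by
    simp_rw [habs]
    exact Equiv.sum_comp τ.1 (fun i => |x i|)
  rw [← srwJ_spAct m l τ x, ← hy]
  rcases le_or_gt (∑ j, y j) (R : ℤ) with hR | hR
  · exact hInner y hanti hge (by rw [hysum]; exact hxs) hR
  · have hR' : (R : ℤ) + 1 ≤ ∑ j, y j := by omega
    obtain ⟨w, hw, hvw, hwy, hwsum⟩ :=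
      exists_antitone_between v hv (∑ j, y j - (R + 1)).toNat y hanti hge (R + 1) hvR hR'
        (Int.self_le_toNat _)
    calc srwJ d m l y ≤ srwJcone d m l w :=
          srwJ_le_srwJcone hm hd l y w (fun j => (hv0 j).trans (hvw j)) (fun j => by rw [hyabs]; exact hwy j)
      _ ≤ M := hFront w hw hvw hwsum

/-- **Rule FIM-SUP, `BoundFThreeInital` form**: with `v = 0` — if `𝓘(w) ≤ M` on the sorted shells
`s ≤ ‖w‖₁ ≤ R` and `B(w) ≤ M` on the sorted shell `‖w‖₁ = R + 1`, then `𝓘(x) ≤ M` for all `x` with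
`‖x‖₁ ≥ s`. [folklore] -/
theorem srwJ_le_of_shellTables {m : ℕ} (hm : 1 ≤ m) (hd : 2 * (m + 1) + 1 ≤ d) (l s R : ℕ) (M : ℝ)
    (hInner : ∀ w : Fin d → ℤ, Antitone w → (∀ j, 0 ≤ w j) → (s : ℤ) ≤ ∑ j, w j →
      ∑ j, w j ≤ R → srwJ d m l w ≤ M)
    (hFront : ∀ w : Fin d → ℤ, Antitone w → (∀ j, 0 ≤ w j) → ∑ j, w j = R + 1 →
      srwJcone d m l w ≤ M)
    (x : Fin d → ℤ) (hxs : (s : ℤ) ≤ ∑ j, |x j|) : srwJ d m l x ≤ M :=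
  srwJ_le_of_coneTables hm hd l s R M 0 (fun _ _ _ => le_rfl) (fun _ => le_rfl)
    (by simp only [Pi.zero_apply, Finset.sum_const_zero]; positivity) hInner hFront x
    (fun j => abs_nonneg _) hxs



/-! ### Enumeration: sorted non-negative vectors of given `ℓ¹`-norm = an explicit list of partitions

For certificate files: the premises of `srwJ_le_of_coneTables` quantify over all sorted `w`; the
following turns them into a conjunction over the computable list `partsLe r r r` of partitions of `r`
(`partsLe 4 4 4 = [[1,1,1,1],[2,1,1],[2,2],[3,1],[4]]` by `rfl`/`decide`), embedded into `ℤ^d` by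
zero-padding (`vecOfParts`). -/

/-- `partsLe fuel r b`: the non-increasing lists of POSITIVE naturals with sum `r` and head `≤ b`
(complete when `fuel ≥ r`; structural recursion on `fuel`). [folklore] -/
def partsLe : ℕ → ℕ → ℕ → List (List ℕ)
  | 0, r, _ => if r = 0 then [[]] else []
  | fuel + 1, r, b =>
      if r = 0 then [[]]
      else (List.range' 1 (min b r)).flatMap fun a => (partsLe fuel (r - a) a).map (a :: ·)

/-- Zero-padded embedding of a list of parts into `ℤ^d`: `(p₀, p₁, …, p_{k-1}, 0, …, 0)`. [folklore] -/
def vecOfParts (d : ℕ) (p : List ℕ) : Fin d → ℤ := fun j => ((p.getD (j : ℕ) 0 : ℕ) : ℤ)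

example : partsLe 4 4 4 = [[1, 1, 1, 1], [2, 1, 1], [2, 2], [3, 1], [4]] := by decide

/-- COMPLETENESS: every sorted (non-increasing) `w ∈ ℤ^d_{≥0}` with `Σ w = r`, entries `≤ b`, is the
zero-padding of some `p ∈ partsLe fuel r b` (`fuel ≥ r`). [folklore] -/
theorem exists_mem_partsLe : ∀ (d fuel r b : ℕ) (w : Fin d → ℤ), Antitone w → (∀ j, 0 ≤ w j) →
    (∀ j, w j ≤ b) → ∑ j, w j = r → r ≤ fuel → ∃ p ∈ partsLe fuel r b, w = vecOfParts d p := by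
  intro d
  induction d with
  | zero =>
      intro fuel r b w _ _ _ hsum _
      have hr : r = 0 := by
        have : (r : ℤ) = 0 := by rw [← hsum]; simp
        exact_mod_cast this
      subst hr
      refine ⟨[], ?_, funext fun j => j.elim0⟩
      cases fuel <;> simp [partsLe]
  | succ d ih =>
      intro fuel r b w hw hw0 hwb hsum hfuel
      have hsum' : ∑ j : Fin (d + 1), w j = w 0 + ∑ i : Fin d, w i.succ := Fin.sum_univ_succ w
      by_cases ha : w 0 = 0
      · -- the zero vector
        have hall : ∀ j, w j = 0 := fun j =>
          le_antisymm (ha ▸ hw (Fin.zero_le j)) (hw0 j)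
        have hr : r = 0 := by
          have : (r : ℤ) = 0 := by rw [← hsum]; simp [hall]
          exact_mod_cast this
        subst hr
        refine ⟨[], ?_, funext fun j => by simp [vecOfParts, hall]⟩
        cases fuel <;> simp [partsLe]
      · have ha1 : 1 ≤ w 0 := by have := hw0 0; omega
        set a : ℕ := (w 0).toNat with ha_def
        have haw : (a : ℤ) = w 0 := Int.toNat_of_nonneg (hw0 0)
        set t : Fin d → ℤ := fun i => w i.succ with ht
        have htanti : Antitone t := fun i j hij => hw (Fin.succ_le_succ_iff.mpr hij)
        have ht0 : ∀ i, 0 ≤ t i := fun i => hw0 _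
        have hta : ∀ i, t i ≤ (a : ℤ) := fun i => by rw [haw]; exact hw (Fin.zero_le _)
        have htnn : 0 ≤ ∑ i, t i := Finset.sum_nonneg fun i _ => ht0 i
        have har : a ≤ r := by
          have : (a : ℤ) ≤ r := by rw [haw, ← hsum, hsum']; linarith
          exact_mod_cast this
        have hab : a ≤ b := by
          have : (a : ℤ) ≤ b := by rw [haw]; exact hwb 0
          exact_mod_cast this
        have htsum : ∑ i, t i = ((r - a : ℕ) : ℤ) := by
          rw [Nat.cast_sub har, ← hsum, hsum', ← haw]
          simp [ht]
        obtain ⟨fuel', rfl⟩ : ∃ f, fuel = f + 1 := ⟨fuel - 1, by omega⟩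
        obtain ⟨p', hp', htp'⟩ := ih fuel' (r - a) a t htanti ht0 hta htsum (by omega)
        refine ⟨a :: p', ?_, ?_⟩
        · have hr0 : r ≠ 0 := by omega
          simp only [partsLe, if_neg hr0, List.mem_flatMap, List.mem_map, List.mem_range'_1]
          exact ⟨a, ⟨by omega, by omega⟩, p', hp', rfl⟩
        · funext j
          refine Fin.cases ?_ (fun i => ?_) j
          · simp [vecOfParts, haw]
          · have := congrFun htp' i
            simp only [vecOfParts, ht] at this
            simpa [vecOfParts] using this

/-- Sorted vectors dominating `v` with `ℓ¹`-norm `r` are among the zero-paddings of `partsLe r r r`.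
[folklore] -/
theorem exists_mem_partsLe_of_antitone (w : Fin d → ℤ) (hw : Antitone w) (hw0 : ∀ j, 0 ≤ w j)
    (r : ℕ) (hsum : ∑ j, w j = r) : ∃ p ∈ partsLe r r r, w = vecOfParts d p := by
  refine exists_mem_partsLe d r r r w hw hw0 (fun j => ?_) hsum le_rfl
  rw [← hsum]
  exact Finset.single_le_sum (fun i _ => hw0 i) (Finset.mem_univ j)

/-- **Rule FIM-SUP, certificate form.**  As `srwJ_le_of_coneTables`, with the sorted-vector premises
replaced by conjunctions over the explicit partition lists `partsLe r r r`, `s ≤ r ≤ R` (inner) and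
`partsLe (R+1) (R+1) (R+1)` (frontier); non-dominating partitions are discharged by `decide` on the
false premise `v ≤ vecOfParts d p`. [folklore] -/
theorem srwJ_le_of_partsTables {m : ℕ} (hm : 1 ≤ m) (hd : 2 * (m + 1) + 1 ≤ d) (l s R : ℕ) (M : ℝ)
    (v : Fin d → ℤ) (hv : Antitone v) (hv0 : ∀ j, 0 ≤ v j) (hvR : ∑ j, v j ≤ R + 1)
    (hInner : ∀ r : ℕ, s ≤ r → r ≤ R → ∀ p ∈ partsLe r r r, (∀ j, v j ≤ vecOfParts d p j) →
      srwJ d m l (vecOfParts d p) ≤ M)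
    (hFront : ∀ p ∈ partsLe (R + 1) (R + 1) (R + 1), (∀ j, v j ≤ vecOfParts d p j) →
      srwJcone d m l (vecOfParts d p) ≤ M)
    (x : Fin d → ℤ) (hx : ∀ j, v j ≤ |x j|) (hxs : (s : ℤ) ≤ ∑ j, |x j|) :
    srwJ d m l x ≤ M := by
  refine srwJ_le_of_coneTables hm hd l s R M v hv hv0 hvR ?_ ?_ x hx hxs
  · intro w hw hvw hsw hwR
    have hw0 : ∀ j, 0 ≤ w j := fun j => (hv0 j).trans (hvw j)
    have hnn : 0 ≤ ∑ j, w j := Finset.sum_nonneg fun j _ => hw0 j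
    obtain ⟨p, hp, rfl⟩ :=
      exists_mem_partsLe_of_antitone w hw hw0 (∑ j, w j).toNat (Int.toNat_of_nonneg hnn).symm
    exact hInner _ (by omega) (by omega) p hp hvw
  · intro w hw hvw hwR
    have hw0 : ∀ j, 0 ≤ w j := fun j => (hv0 j).trans (hvw j)
    obtain ⟨p, hp, rfl⟩ := exists_mem_partsLe_of_antitone w hw hw0 (R + 1) (by exact_mod_cast hwR)
    exact hFront p hp hvw

end Literature.Probability.FitznerVanDerHofstad2017
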